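import Mathlib

/-!
# `WeightedInvariant.LocalWeightedDrop`, line `tame-four-tuple-drop`: Perron's pair step for Hironaka's polyhedra game
# (two exponent vectors are made comparable; combinatorics only)

Crux item stmt-ResolutionOfSingularities-8899 `LocalWeightedDrop` (route `ResolutionOfSingularities/WeightedInvariant`); stub (B3)
`stub_spaceMonomialPhase` of strategist res-L1-w43-strat-1's line `tame-four-tuple-drop` (the MONOMIAL PHASE of the coefficient-tuple game
in three variables; this file is dimension-free).  [OURS · L1 W4.3, chain w43, unit res-L1-w43-stub-8 (seat res-D-pv-006); the mathematics is
the two-point case of Hironaka's polyhedra game as proved in J. Novacoski–M. Spivakovsky-style «Perron transforms and Hironaka's game»,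
arXiv:1907.02094, Prop. 2.2 (= the pair step of M. Spivakovsky, *A solution to Hironaka's polyhedra game*, 1983); NOT a statement of any
manuscript under adjudication.]

Setting: exponent vectors `α β : ι → ℕ` (`ι` finite).  A move of the polyhedra game is a non-empty set `J` of coordinates and a chart `j ∈ J`;
it replaces the `j`-th coordinate of EVERY vector by the sum of its coordinates over `J` (`push J j`).  The PAIR POTENTIAL is
`τ(α, β) = (min(|ᾱ|, |β̄|), max(|ᾱ|, |β̄|))` (lexicographic) with `|ᾱ| = Σᵢ (αᵢ − βᵢ)⁺` (`posExcess α β`) and `|β̄| = Σᵢ (βᵢ − αᵢ)⁺`; it has first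
component `0` iff `α, β` are comparable.

* `exists_push_pairLt` — **the pair step**: if `α, β` are incomparable there is a non-empty `J` such that for EVERY `j ∈ J` the pair potential
  of `(push J j α, push J j β)` is lexicographically smaller.  (`J = D ∪ K`, `D = {αᵢ > βᵢ}`, `K ⊆ {βᵢ > αᵢ}` inclusion-minimal with
  `Σ_K (βᵢ − αᵢ) ≥ |ᾱ|`, assuming `|ᾱ| ≤ |β̄|`.)
* bookkeeping used by the cloud potential: `posExcess_eq_zero_iff` (comparability), invariance of the excesses under a common shift of one
  coordinate (`posExcess_update_sub`) and under a common re-indexing (`posExcess_comp_equiv`), monotonicity under a common zeroing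
  (`posExcess_zero_le`), and the `pairKey` arithmetic in `ℕ ×ₗ ℕ`.
-/

set_option linter.dupNamespace false -- mandated namespace of this single-conjunct summit

namespace Summit.ResolutionOfSingularities.ResolutionOfSingularities.Theorems

namespace MonomialCloud

open Finset

variable {ι : Type} [Fintype ι]

/-! ### The excesses `|ᾱ|`, `|β̄|` and the pair potential -/

/-- `|ᾱ| = Σᵢ (αᵢ − βᵢ)⁺`: the total excess of `α` over `β` (truncated subtraction). -/
def posExcess (α β : ι → ℕ) : ℕ := ∑ i, (α i - β i)

/-- `α ≤ β` componentwise iff the excess of `α` over `β` vanishes. -/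
theorem posExcess_eq_zero_iff (α β : ι → ℕ) : posExcess α β = 0 ↔ ∀ i, α i ≤ β i := by
  unfold posExcess
  rw [Finset.sum_eq_zero_iff]
  simp only [Finset.mem_univ, true_implies, Nat.sub_eq_zero_iff_le]

/-- The excess only collects the coordinates where `α` is larger. -/
theorem posExcess_eq_sum_filter (α β : ι → ℕ) :
    posExcess α β = ∑ i ∈ univ.filter (fun i => β i < α i), (α i - β i) := by
  unfold posExcess
  rw [Finset.sum_filter]
  refine Finset.sum_congr rfl fun i _ => ?_
  split_ifs with h
  · rfl
  · exact Nat.sub_eq_zero_of_le (not_lt.mp h)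

/-- THE PAIR KEY `(min a b, max a b)` in the lexicographic order `ℕ ×ₗ ℕ` (the pair potential `τ` of two excesses). -/
def pairKey (a b : ℕ) : ℕ ×ₗ ℕ := toLex (min a b, max a b)

/-- Unfolding `pairKey a′ b′ < pairKey a b`. -/
theorem pairKey_lt_iff (a' b' a b : ℕ) :
    pairKey a' b' < pairKey a b ↔ min a' b' < min a b ∨ (min a' b' = min a b ∧ max a' b' < max a b) := by
  unfold pairKey; rw [Prod.Lex.toLex_lt_toLex]

/-- Unfolding `pairKey a′ b′ ≤ pairKey a b`. -/
theorem pairKey_le_iff (a' b' a b : ℕ) :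
    pairKey a' b' ≤ pairKey a b ↔ min a' b' < min a b ∨ (min a' b' = min a b ∧ max a' b' ≤ max a b) := by
  unfold pairKey; rw [Prod.Lex.toLex_le_toLex]

/-- The pair key is symmetric. -/
theorem pairKey_comm (a b : ℕ) : pairKey a b = pairKey b a := by
  unfold pairKey; rw [min_comm, max_comm]

/-- Componentwise smaller arguments give a key that is not larger. -/
theorem pairKey_le_of_le {a' b' a b : ℕ} (ha : a' ≤ a) (hb : b' ≤ b) : pairKey a' b' ≤ pairKey a b := by
  rw [pairKey_le_iff]
  rcases lt_or_eq_of_le (min_le_min ha hb) with h | h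
  · exact Or.inl h
  · exact Or.inr ⟨h, max_le_max ha hb⟩

/-- A strict drop of the first argument below the old minimum lowers the key. -/
theorem pairKey_lt_of_lt_min {a' b' a b : ℕ} (h : a' < min a b) : pairKey a' b' < pairKey a b :=
  (pairKey_lt_iff _ _ _ _).mpr (Or.inl (lt_of_le_of_lt (min_le_left _ _) h))

/-- Keeping the smaller argument and lowering the larger lowers the key. -/
theorem pairKey_lt_of_fst_eq_of_snd_lt {a b' b : ℕ} (hab : a ≤ b) (h : b' < b) : pairKey a b' < pairKey a b := by
  rw [pairKey_lt_iff]
  rcases le_or_gt a b' with h1 | h1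
  · right
    rw [min_eq_left h1, min_eq_left hab, max_eq_right h1, max_eq_right hab]
    exact ⟨rfl, h⟩
  · left
    rw [min_eq_right h1.le, min_eq_left hab]
    exact h1

variable [DecidableEq ι]

/-! ### The move `push J j`: coordinate `j` receives the sum over `J` -/

omit [Fintype ι] in
/-- The polyhedra-game move on one exponent vector: the `j`-th coordinate becomes `Σ_{i ∈ J} vᵢ`. -/
def push (J : Finset ι) (j : ι) (v : ι → ℕ) : ι → ℕ := Function.update v j (∑ i ∈ J, v i)

omit [Fintype ι] in
/-- The pushed coordinate. -/
@[simp] theorem push_apply_self (J : Finset ι) (j : ι) (v : ι → ℕ) : push J j v j = ∑ i ∈ J, v i := by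
  simp [push]

omit [Fintype ι] in
/-- The other coordinates are unchanged. -/
theorem push_apply_of_ne (J : Finset ι) {j i : ι} (h : i ≠ j) (v : ι → ℕ) : push J j v i = v i := by
  simp [push, h]

/-- A sum over all coordinates splits off the coordinate `j`. -/
theorem sum_eq_add_sum_erase (f : ι → ℕ) (j : ι) : ∑ i, f i = f j + ∑ i ∈ univ.erase j, f i :=
  (Finset.add_sum_erase _ _ (Finset.mem_univ j)).symm

/-- The excess after a push: the coordinates `≠ j` are unchanged, the `j`-th term is `(Σ_J α − Σ_J β)⁺`. -/
theorem posExcess_push (J : Finset ι) (j : ι) (α β : ι → ℕ) :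
    posExcess (push J j α) (push J j β) + (α j - β j) =
      posExcess α β + ((∑ i ∈ J, α i) - ∑ i ∈ J, β i) := by
  unfold posExcess
  rw [sum_eq_add_sum_erase _ j, sum_eq_add_sum_erase (fun i => α i - β i) j, push_apply_self, push_apply_self]
  have h : ∑ i ∈ univ.erase j, (push J j α i - push J j β i) = ∑ i ∈ univ.erase j, (α i - β i) :=
    Finset.sum_congr rfl fun i hi => by rw [push_apply_of_ne J (Finset.ne_of_mem_erase hi), push_apply_of_ne J (Finset.ne_of_mem_erase hi)]
  rw [h]
  ring

/-! ### The pair step -/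

/-- THE PAIR STEP, asymmetric form (`|ᾱ| ≤ |β̄|`, both positive): with `D = {βᵢ < αᵢ}` and `K ⊆ {αᵢ < βᵢ}` inclusion-minimal subject to
`Σ_K (βᵢ − αᵢ) ≥ |ᾱ|`, every chart of the move `J = D ∪ K` lowers the pair potential. -/
theorem exists_push_pairLt_of_le (α β : ι → ℕ) (hpos : 0 < posExcess α β) (hle : posExcess α β ≤ posExcess β α) :
    ∃ J : Finset ι, J.Nonempty ∧ ∀ j ∈ J,
      pairKey (posExcess (push J j α) (push J j β)) (posExcess (push J j β) (push J j α)) <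
        pairKey (posExcess α β) (posExcess β α) := by
  classical
  set D : Finset ι := univ.filter (fun i => β i < α i) with hD
  set E : Finset ι := univ.filter (fun i => α i < β i) with hE
  set P : ℕ := posExcess α β with hP
  -- the qualifying subsets of `E` and a minimal-cardinality one
  have hEq : P ≤ ∑ i ∈ E, (β i - α i) := by rw [hE, ← posExcess_eq_sum_filter]; exact hle
  obtain ⟨K, hKmem, hKmin⟩ := (E.powerset.filter fun K => P ≤ ∑ i ∈ K, (β i - α i)).exists_min_image Finset.card
    ⟨E, by simp [hEq]⟩
  rw [Finset.mem_filter, Finset.mem_powerset] at hKmem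
  obtain ⟨hKE, hKsum⟩ := hKmem
  -- minimality: removing any element breaks the inequality
  have hKerase : ∀ j ∈ K, ∑ i ∈ K.erase j, (β i - α i) < P := by
    intro j hj
    by_contra hge
    push Not at hge
    have hmem : K.erase j ∈ E.powerset.filter fun K => P ≤ ∑ i ∈ K, (β i - α i) := by
      rw [Finset.mem_filter, Finset.mem_powerset]
      exact ⟨(Finset.erase_subset j K).trans hKE, hge⟩
    have := hKmin _ hmem
    rw [Finset.card_erase_of_mem hj] at this
    have hpos' : 0 < K.card := Finset.card_pos.mpr ⟨j, hj⟩
    omega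
  have hDE : Disjoint D E := by
    rw [hD, hE, Finset.disjoint_filter]
    intro i _ h1 h2
    exact lt_asymm h1 h2
  have hDK : Disjoint D K := hDE.mono_right hKE
  have hDne : D.Nonempty := by
    by_contra h
    rw [Finset.not_nonempty_iff_eq_empty] at h
    have : P = 0 := by rw [hP, posExcess_eq_sum_filter, ← hD, h, Finset.sum_empty]
    omega
  refine ⟨D ∪ K, hDne.mono Finset.subset_union_left, fun j hj => ?_⟩
  -- the sums over `J = D ∪ K`
  have hsumα : ∑ i ∈ D ∪ K, α i = ∑ i ∈ D, α i + ∑ i ∈ K, α i := Finset.sum_union hDK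
  have hsumβ : ∑ i ∈ D ∪ K, β i = ∑ i ∈ D, β i + ∑ i ∈ K, β i := Finset.sum_union hDK
  have hDsum : ∑ i ∈ D, α i = ∑ i ∈ D, β i + P := by
    rw [hP, posExcess_eq_sum_filter, ← hD, ← Finset.sum_add_distrib]
    exact Finset.sum_congr rfl fun i hi => by
      rw [hD, Finset.mem_filter] at hi
      omega
  have hKsum' : ∑ i ∈ K, β i = ∑ i ∈ K, α i + ∑ i ∈ K, (β i - α i) := by
    rw [← Finset.sum_add_distrib]
    exact Finset.sum_congr rfl fun i hi => by
      have hi' := hKE hi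
      rw [hE, Finset.mem_filter] at hi'
      omega
  set r : ℕ := ∑ i ∈ K, (β i - α i) - P with hr
  have hST : ∑ i ∈ D ∪ K, β i = ∑ i ∈ D ∪ K, α i + r := by rw [hsumα, hsumβ, hDsum, hKsum', hr]; omega
  have hdiff1 : (∑ i ∈ D ∪ K, α i) - ∑ i ∈ D ∪ K, β i = 0 := by rw [hST]; omega
  have hdiff2 : (∑ i ∈ D ∪ K, β i) - ∑ i ∈ D ∪ K, α i = r := by rw [hST]; omega
  -- the new excesses
  have hnewP := posExcess_push (D ∪ K) j α β
  have hnewN := posExcess_push (D ∪ K) j β α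
  rw [hdiff1, add_zero] at hnewP
  rw [hdiff2] at hnewN
  rcases Finset.mem_union.mp hj with hjD | hjK
  · -- chart in `D`: `|ᾱ|` drops strictly below the old minimum `|ᾱ|`
    have hj' : β j < α j := by rw [hD, Finset.mem_filter] at hjD; exact hjD.2
    apply pairKey_lt_of_lt_min
    rw [min_eq_left hle]
    have : 0 < α j - β j := by omega
    omega
  · -- chart in `K`: `|ᾱ|` is kept and `|β̄|` drops
    have hj' : α j < β j := by
      have := hKE hjK
      rw [hE, Finset.mem_filter] at this; exact this.2
    have hαβ : α j - β j = 0 := by omega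
    rw [hαβ, add_zero] at hnewP
    rw [hnewP]
    have hrlt : r < β j - α j := by
      have h1 := hKerase j hjK
      have h2 : ∑ i ∈ K, (β i - α i) = (β j - α j) + ∑ i ∈ K.erase j, (β i - α i) :=
        (Finset.add_sum_erase _ _ hjK).symm
      omega
    have hlt : posExcess (push (D ∪ K) j β) (push (D ∪ K) j α) < posExcess β α := by omega
    exact pairKey_lt_of_fst_eq_of_snd_lt hle hlt

/-- **THE PAIR STEP** (Perron / Spivakovsky): two incomparable exponent vectors admit a move `J ≠ ∅` of the polyhedra game under EVERY chart
`j ∈ J` of which the pair potential `(min(|ᾱ|, |β̄|), max(|ᾱ|, |β̄|))` drops lexicographically. -/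
theorem exists_push_pairLt (α β : ι → ℕ) (hα : 0 < posExcess α β) (hβ : 0 < posExcess β α) :
    ∃ J : Finset ι, J.Nonempty ∧ ∀ j ∈ J,
      pairKey (posExcess (push J j α) (push J j β)) (posExcess (push J j β) (push J j α)) <
        pairKey (posExcess α β) (posExcess β α) := by
  rcases le_total (posExcess α β) (posExcess β α) with h | h
  · exact exists_push_pairLt_of_le α β hα h
  · obtain ⟨J, hJ, hstep⟩ := exists_push_pairLt_of_le β α hβ h
    refine ⟨J, hJ, fun j hj => ?_⟩
    rw [pairKey_comm, pairKey_comm (posExcess α β)]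
    exact hstep j hj

/-! ### Invariances of the excesses -/

/-- A common shift of one coordinate (no truncation) does not change the excess. -/
theorem posExcess_update_sub (α β : ι → ℕ) (j : ι) (c : ℕ) (hα : c ≤ α j) (hβ : c ≤ β j) :
    posExcess (Function.update α j (α j - c)) (Function.update β j (β j - c)) = posExcess α β := by
  unfold posExcess
  refine Finset.sum_congr rfl fun i _ => ?_
  by_cases h : i = j
  · subst h; simp only [Function.update_self]; omega
  · simp [Function.update_of_ne h]

/-- Zeroing a common set of coordinates does not increase the excess. -/
theorem posExcess_zero_le (α β : ι → ℕ) (Z : Finset ι) :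
    posExcess (fun i => if i ∈ Z then 0 else α i) (fun i => if i ∈ Z then 0 else β i) ≤ posExcess α β := by
  unfold posExcess
  refine Finset.sum_le_sum fun i _ => ?_
  dsimp only
  split_ifs <;> simp

omit [DecidableEq ι] in
/-- A common re-indexing of the coordinates does not change the excess. -/
theorem posExcess_comp_equiv {ι' : Type} [Fintype ι'] (σ : ι' ≃ ι) (α β : ι → ℕ) :
    posExcess (α ∘ σ) (β ∘ σ) = posExcess α β := by
  unfold posExcess
  exact Fintype.sum_equiv σ _ _ fun _ => rfl

/-- Modifying one coordinate to arbitrary (common-difference) values: if the new `j`-th values satisfy `a′ − b′ = (a − b)` and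
`b′ − a′ = b − a` (as truncated differences) nothing changes — used for «sum over `J` minus a common `c`». -/
theorem posExcess_update_eq (α β : ι → ℕ) (j : ι) (a b : ℕ) (h : a - b = α j - β j) :
    posExcess (Function.update α j a) (Function.update β j b) = posExcess α β := by
  unfold posExcess
  refine Finset.sum_congr rfl fun i _ => ?_
  by_cases hi : i = j
  · subst hi; simp only [Function.update_self]; exact h
  · simp [Function.update_of_ne hi]

omit [Fintype ι] in
/-- The pushed-then-shifted vector: `push J j` followed by subtracting a common `c ≤ Σ_J` from coordinate `j`. -/
theorem push_sub_eq_update (J : Finset ι) (j : ι) (v : ι → ℕ) (c : ℕ) :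
    Function.update (push J j v) j (push J j v j - c) = Function.update v j ((∑ i ∈ J, v i) - c) := by
  funext i
  by_cases hi : i = j
  · subst hi; simp [push]
  · simp [push, Function.update_of_ne hi]

end MonomialCloud

end Summit.ResolutionOfSingularities.ResolutionOfSingularities.Theorems
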